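import Literature.NumberTheory.EllipticCurves.ModularSymbolsClassicalWeightTwo
import Literature.NumberTheory.EllipticCurves.ModularSymbolsPlusMinus
import Literature.NumberTheory.EllipticCurves.ModularSymbolsValuesBounded
import Literature.NumberTheory.EllipticCurves.ModularSymbolsMeasureApproximations
import Literature.NumberTheory.EllipticCurves.PAdicLFunctionDistributionHoldsProofs
import HarnessLib

/-!
# The rational plus symbol of a rational newform as a `p`-stabilised `U_p`-eigensymbol over `ℤ_p`

For a normalised newform `f ∈ S₂(Γ₀(N))` with rational coefficients and real period `Ω⁺_f ≠ 0`
the tree's RATIONAL plus symbols `[r]⁺_f ∈ ℚ` (`PAdicLFunction.ratPlusSymbol`, cast to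
`re(plusSymbol)/Ω⁺` by the discharged fact `ratCast_ratPlusSymbol_holds`) assemble into the
**rational weight-`2` plus symbol `ratSymb f (x, y) = [y]⁺ − [x]⁺ ∈ Symb_{Γ₀(N)}(Sym⁰ ℚ)`**
(`ratSymb_mem_Symb`), a `T_p`-eigensymbol with eigenvalue `a_p(f) ∈ ℚ` (`hecke_ratSymb`): after
casting to `ℂ` it is `(2Ω⁺)⁻¹` times the plus part (`ModularSymbolsPlusMinus.plusPart`) of the
classical symbol `{x, y}_f` (`ModularSymbolsClassicalWeightTwo.clSymb`), and `Symb`-membership and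
Hecke equations are reflected along `ℚ ↪ ℂ` (`ModularSymbolsValuesBounded.mapZero_mem_Symb_iff`).
Pushing to `ℚ_p`, `p`-stabilising at a unit root `α ∈ ℤ_p^×` of `X² − a_p X + p` (`p ∤ N`,
`ModularSymbolsPStabilisation.symPow_pStabilise`) and clearing the (bounded) denominators
(`ModularSymbolsValuesBounded.exists_pow_mul_apply_norm_le_one`) yields
**an exact `U_p`-eigensymbol `Φ ∈ Symb_{Γ₀(Np)}(Sym⁰ ℤ_p)` with unit eigenvalue `α` whose values are
`p^m ([y]⁺ − [x]⁺ − α⁻¹([py]⁺ − [px]⁺))`** (`exists_intStabSymb`) — the input of the slope-`0`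
control theorem with measure coefficients
(`ModularSymbolsOrdinaryMeasuresApprox.existsUnique_measureValued_eigensymbol_of_exact`), whose
output carries the Mazur–Tate–Teitelbaum measure `μ_{f,α}` (`PAdicLFunction.msdMeasure`).

Everything is proved; no named facts (the tree's facts used here are the DISCHARGED
`ratCast_ratPlusSymbol_holds`, `modularSymbol_neg_eq_conj_holds`).

## References

* B. Mazur, J. Tate, J. Teitelbaum, Invent. Math. 84 (1986), §I.8, §I.10. [MazurTateTeitelbaum1986Invent]
* R. Greenberg, G. Stevens, Invent. Math. 111 (1993), §4, (4.8)–(4.9). [GreenbergStevens1993]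
-/

noncomputable section

open scoped MatrixGroups ModularForm
open Matrix CongruenceSubgroup

namespace Literature.NumberTheory.EllipticCurves

open ModularForms ModularForms.HidaCohomology

/-! ### The plus potential and the plus part of the classical symbol -/

section Plus

variable {N : ℕ} (h : CuspForm (Gamma0 N) 2) (S : Set (Matrix (Fin 2) (Fin 2) ℤ))

/-- The plus potential `({∞, x} + {∞, ιx})/2`. [cite: MazurTateTeitelbaum1986Invent, §I.8] -/
def plusPot (x : P1Q) : ℂ := (msPot h x + msPot h (P1Q.act iotaMat x)) / 2

/-- `plusPot` at a finite cusp is the tree's `plusSymbol`. [folklore] -/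
theorem plusPot_ofRat (r : ℚ) : plusPot h (P1Q.ofRat r) = plusSymbol h r := by
  rw [plusPot, P1Q.act_iotaMat_ofRat, msPot_ofRat, msPot_ofRat, plusSymbol]

/-- `plusPot ∞ = 0`. [folklore] -/
theorem plusPot_infty : plusPot h P1Q.infty = 0 := by
  rw [plusPot, P1Q.act_iotaMat_infty, msPot_infty, add_zero, zero_div]

/-- **The plus part of `{x, y}_h` is `2 ([y]_+ − [x]_+)`** with `[·]_+` the plus potential. [cite: MazurTateTeitelbaum1986Invent, §I.8] -/
theorem plusPart_clSymb_apply (x y : P1Q) (i : Fin 1) :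
    (CoeffActionOn.symPowOn S 0 ℂ).plusPart (clSymb h) x y i = 2 * (plusPot h y - plusPot h x) := by
  rw [CoeffActionOn.plusPart, Pi.add_apply, Pi.add_apply, Pi.add_apply, symPowOn_zero_slash, clSymb_apply, clSymb_apply, plusPot, plusPot]
  ring

end Plus

/-! ### The rational plus symbol -/

section Rational

variable {N : ℕ} (f : CuspForm (Gamma0 N) 2) {p : ℕ} [Fact p.Prime]

open Classical in
/-- The rational plus potential `[x]⁺_f` (`0` at `∞`). [cite: MazurTateTeitelbaum1986Invent, §I.8] -/
def ratPot (x : P1Q) : ℚ :=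
  if hx : ∃ r : ℚ, x = P1Q.ofRat r then ratPlusSymbol f hx.choose else 0

/-- `[∞]⁺ = 0`. [folklore] -/
theorem ratPot_infty : ratPot f P1Q.infty = 0 := by
  have hn : ¬ ∃ r : ℚ, P1Q.infty = P1Q.ofRat r := fun ⟨r, hr⟩ => ofRat_ne_infty r hr.symm
  unfold ratPot
  rw [dif_neg hn]

/-- `[r]⁺` at a finite cusp. [folklore] -/
theorem ratPot_ofRat (r : ℚ) : ratPot f (P1Q.ofRat r) = ratPlusSymbol f r := by
  have hx : ∃ r' : ℚ, P1Q.ofRat r = P1Q.ofRat r' := ⟨r, rfl⟩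
  have hr : hx.choose = r := (ofRat_injective hx.choose_spec).symm
  unfold ratPot
  rw [dif_pos hx, hr]

/-- **The rational plus symbol `[y]⁺ − [x]⁺`** with values in `Sym⁰ ℚ`. [cite: MazurTateTeitelbaum1986Invent, §I.8] -/
def ratSymb : P1Q → P1Q → (Fin 1 → ℚ) := fun x y _ => ratPot f y - ratPot f x

/-- Unfolding `ratSymb`. [folklore] -/
@[simp] theorem ratSymb_apply (x y : P1Q) (i : Fin 1) : ratSymb f x y i = ratPot f y - ratPot f x := rfl

variable [NeZero N]

/-- **Cast of the rational plus potential**: `([x]⁺ : ℂ) = plusPot f x / Ω⁺_f` for a rational newform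
with `Ω⁺_f ≠ 0`. [cite: MazurTateTeitelbaum1986Invent, §I.8] -/
theorem ratCast_ratPot (hf : IsNewform0 f) (hQ : coeffField f = ⊥) (x : P1Q) :
    ((ratPot f x : ℚ) : ℂ) = plusPot f x / (plusPeriod f : ℂ) := by
  rcases P1Q.infty_or_ofRat x with rfl | ⟨r, rfl⟩
  · rw [ratPot_infty, plusPot_infty, Rat.cast_zero, zero_div]
  · rw [ratPot_ofRat, plusPot_ofRat]
    have hreal := plusSymbol_eq_re_of f (modularSymbol_neg_eq_conj_holds f) (cuspCoeff_im_eq_zero_of_coeffField_eq_bot hQ) r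
    have hcast : ((ratPlusSymbol f r : ℚ) : ℝ) = (plusSymbol f r).re / plusPeriod f := by
      rw [ratCast_ratPlusSymbol_holds hf hQ r, normalizedPlusSymbol]
    have hC : ((ratPlusSymbol f r : ℚ) : ℂ) = ((((ratPlusSymbol f r : ℚ) : ℝ)) : ℂ) := by norm_cast
    rw [hC, hcast, Complex.ofReal_div]
    congr 1
    rw [hreal, Complex.ofReal_re]

/-- **`ratSymb f` cast to `ℂ` is `(2Ω⁺)⁻¹ · ({x,y}_f)⁺`.** [cite: MazurTateTeitelbaum1986Invent, §I.8] -/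
theorem mapZero_ratSymb (S : Set (Matrix (Fin 2) (Fin 2) ℤ)) (hf : IsNewform0 f) (hQ : coeffField f = ⊥) (hΩ : plusPeriod f ≠ 0) :
    mapZero (Rat.castHom ℂ) (ratSymb f) = ((2 * (plusPeriod f : ℂ))⁻¹) • (CoeffActionOn.symPowOn S 0 ℂ).plusPart (clSymb f) := by
  have hΩ' : (plusPeriod f : ℂ) ≠ 0 := by exact_mod_cast hΩ
  funext x y i
  rw [mapZero_apply, ratSymb_apply, Pi.smul_apply, Pi.smul_apply, Pi.smul_apply, plusPart_clSymb_apply, smul_eq_mul, Rat.coe_castHom,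
    Rat.cast_sub, ratCast_ratPot f hf hQ, ratCast_ratPot f hf hQ]
  field_simp

/-- **`[y]⁺ − [x]⁺ ∈ Symb_{Γ₀(N)}(Sym⁰ ℚ)`.** [cite: MazurTateTeitelbaum1986Invent, §I.8] -/
theorem ratSymb_mem_Symb (hf : IsNewform0 f) (hQ : coeffField f = ⊥) (hΩ : plusPeriod f ≠ 0) :
    ratSymb f ∈ (CoeffActionOn.symPowOn (sigma0Set N) 0 ℚ).Symb (Gamma0 N) := by
  rw [← mapZero_mem_Symb_iff (σ := Rat.castHom ℂ) (Rat.castHom ℂ).injective, mapZero_ratSymb f (sigma0Set N) hf hQ hΩ]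
  refine Submodule.smul_mem _ _ ((CoeffActionOn.symPowOn (sigma0Set N) 0 ℂ).plusPart_mem_Symb ?_ (fun γ hγ => coe_mem_sigma0Set' γ hγ)
    (clSymb_mem_Symb f (sigma0Set N)))
  exact ⟨det_iotaMat_ne_zero, by simp, by rw [iotaMat_apply00]; exact (isCoprime_one_left).neg_left⟩

/-- `ι ∈ Σ₀(N)`. [folklore] -/
theorem iotaMat_mem_sigma0Set (N : ℕ) : iotaMat ∈ sigma0Set N :=
  ⟨det_iotaMat_ne_zero, by simp, by rw [iotaMat_apply00]; exact (isCoprime_one_left).neg_left⟩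

/-- **`T_p ([y]⁺ − [x]⁺) = a_p ([y]⁺ − [x]⁺)`** with `a_p = a_p(f) ∈ ℚ`. [cite: MazurTateTeitelbaum1986Invent, §I.8] -/
theorem hecke_ratSymb (hf : IsNewform0 f) (hQ : coeffField f = ⊥) (hΩ : plusPeriod f ≠ 0) {ap : ℚ} (hap : (ap : ℂ) = cuspCoeff f p) :
    (CoeffActionOn.symPowOn (sigma0Set N) 0 ℚ).hecke N p (ratSymb f) = ap • ratSymb f := by
  haveI : NeZero p := ⟨(Fact.out : p.Prime).ne_zero⟩
  rw [← hecke_mapZero_eq_smul_iff (σ := Rat.castHom ℂ) (Rat.castHom ℂ).injective, mapZero_ratSymb f (sigma0Set N) hf hQ hΩ, map_smul,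
    Rat.coe_castHom, hap, smul_comm]
  congr 1
  have heig : heckeT (Gamma0 N) 2 p f = cuspCoeff f p • f := hf.heckeT_eq_coeff_smul Fact.out
  exact (CoeffActionOn.symPowOn (sigma0Set N) 0 ℂ).hecke_plusPart (sigma0Set_mulClosed N) (Fact.out : p.Prime).ne_zero (iotaMat_mem_sigma0Set N)
    (fun γ hγ => coe_mem_sigma0Set' γ hγ) (fun i => heckeRep_mem_sigma0Set Fact.out i) (clSymb_mem_Symb f (sigma0Set N))
    (hecke_clSymb_of_eigen f (sigma0Set N) heig)

end Rational

/-! ### To `ℚ_p`, `p`-stabilisation and integral rescaling -/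

section Padic

variable {N : ℕ} [NeZero N] (f : CuspForm (Gamma0 N) 2) {p : ℕ} [Fact p.Prime]

/-- **The rational plus symbol over `ℚ_p`.** [folklore] -/
def padSymb : P1Q → P1Q → (Fin 1 → ℚ_[p]) := mapZero (Rat.castHom ℚ_[p]) (ratSymb f)

omit [NeZero N] in
/-- Values of `padSymb`. [folklore] -/
@[simp] theorem padSymb_apply (x y : P1Q) (i : Fin 1) : padSymb f (p := p) x y i = ((ratPot f y - ratPot f x : ℚ) : ℚ_[p]) := rfl

/-- `padSymb f ∈ Symb_{Γ₀(N)}(Sym⁰ ℚ_p)`. [folklore] -/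
theorem padSymb_mem_Symb (hf : IsNewform0 f) (hQ : coeffField f = ⊥) (hΩ : plusPeriod f ≠ 0) :
    padSymb f (p := p) ∈ (CoeffActionOn.symPowOn (sigma0Set N) 0 ℚ_[p]).Symb (Gamma0 N) :=
  (mapZero_mem_Symb_iff (σ := Rat.castHom ℚ_[p]) (Rat.castHom ℚ_[p]).injective _).mpr (ratSymb_mem_Symb f hf hQ hΩ)

/-- `T_p (padSymb f) = a_p • padSymb f`. [folklore] -/
theorem hecke_padSymb (hf : IsNewform0 f) (hQ : coeffField f = ⊥) (hΩ : plusPeriod f ≠ 0) {ap : ℚ} (hap : (ap : ℂ) = cuspCoeff f p) :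
    (CoeffActionOn.symPowOn (sigma0Set N) 0 ℚ_[p]).hecke N p (padSymb f) = (ap : ℚ_[p]) • padSymb f := by
  haveI : NeZero p := ⟨(Fact.out : p.Prime).ne_zero⟩
  have h := (hecke_mapZero_eq_smul_iff (S := sigma0Set N) (N := N) (p := p) (σ := Rat.castHom ℚ_[p]) (Rat.castHom ℚ_[p]).injective
    (ratSymb f) ap).mpr (hecke_ratSymb f hf hQ hΩ hap)
  rwa [Rat.coe_castHom] at h

omit [NeZero N] in
/-- `δ ∈ Σ₀(N)` for `p ∤ N`. [folklore] -/
theorem deltaMat_mem_sigma0Set (hpN : ¬ p ∣ N) : deltaMat p ∈ sigma0Set N := by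
  refine ⟨by rw [det_deltaMat]; exact_mod_cast (Fact.out : p.Prime).ne_zero, by simp, ?_⟩
  rw [deltaMat_apply00]
  exact Int.isCoprime_iff_gcd_eq_one.mpr (by
    rw [Int.gcd_natCast_natCast]
    exact (Fact.out : p.Prime).coprime_iff_not_dvd.mpr hpN)

/-- **The `p`-stabilised plus symbol over `ℚ_p`**, `padSymb f − α⁻¹ (padSymb f)|δ`. [cite: MazurTateTeitelbaum1986Invent, §I.10] -/
def padStabSymb (α : ℚ_[p]ˣ) : P1Q → P1Q → (Fin 1 → ℚ_[p]) :=
  padSymb f - ((α⁻¹ : ℚ_[p]ˣ) : ℚ_[p]) • (CoeffActionOn.symPowOn (sigma0Set N) 0 ℚ_[p]).slash (deltaMat p) (padSymb f)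

omit [NeZero N] in
/-- Unfolding `padStabSymb`. [folklore] -/
theorem padStabSymb_def (α : ℚ_[p]ˣ) :
    padStabSymb f α = padSymb f - ((α⁻¹ : ℚ_[p]ˣ) : ℚ_[p]) • (CoeffActionOn.symPowOn (sigma0Set N) 0 ℚ_[p]).slash (deltaMat p) (padSymb f) := rfl

/-- **For `p ∤ N` and a unit `α` of `ℚ_p` with `α² − a_p α + p = 0`, `padStabSymb f α ∈ Symb_{Γ₀(Np)}(Sym⁰ ℚ_p)`
and `U_p` acts by `α`.** [cite: MazurTateTeitelbaum1986Invent, §I.10] -/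
theorem padStabSymb_spec (hf : IsNewform0 f) (hQ : coeffField f = ⊥) (hΩ : plusPeriod f ≠ 0) (hpN : ¬ p ∣ N) {ap : ℚ}
    (hap : (ap : ℂ) = cuspCoeff f p) (α : ℚ_[p]ˣ) (hα : (α : ℚ_[p]) ^ 2 - (ap : ℚ_[p]) * α + p = 0) :
    padStabSymb f α ∈ (CoeffActionOn.symPowOn (sigma0Set N) 0 ℚ_[p]).Symb (Gamma0 (N * p)) ∧
      (CoeffActionOn.symPowOn (sigma0Set N) 0 ℚ_[p]).hecke (N * p) p (padStabSymb f α) = (α : ℚ_[p]) • padStabSymb f α := by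
  haveI : NeZero p := ⟨(Fact.out : p.Prime).ne_zero⟩
  refine symPow_pStabilise (Fact.out : p.Prime).ne_zero hpN (deltaMat_mem_sigma0Set hpN)
    (fun j => heckeRep_mem_sigma0Set Fact.out ⟨some j, fun h => absurd h (Option.some_ne_none j)⟩) (fun γ hγ => coe_mem_sigma0Set' γ hγ)
    (padSymb_mem_Symb f hf hQ hΩ) (hecke_padSymb f hf hQ hΩ hap) α ?_
  rw [zero_add, pow_one]; exact hα

omit [NeZero N] in
/-- **Values of the stabilised symbol**: `[y]⁺ − [x]⁺ − α⁻¹ ([δy]⁺ − [δx]⁺)`. [folklore] -/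
theorem padStabSymb_apply (α : ℚ_[p]ˣ) (x y : P1Q) (i : Fin 1) :
    padStabSymb f α x y i =
      ((ratPot f y - ratPot f x : ℚ) : ℚ_[p]) -
        ((α⁻¹ : ℚ_[p]ˣ) : ℚ_[p]) * ((ratPot f (P1Q.act (deltaMat p) y) - ratPot f (P1Q.act (deltaMat p) x) : ℚ) : ℚ_[p]) := by
  rw [padStabSymb_def, Pi.sub_apply, Pi.sub_apply, Pi.sub_apply, Pi.smul_apply, Pi.smul_apply, Pi.smul_apply, symPowOn_zero_slash,
    padSymb_apply, padSymb_apply, smul_eq_mul]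

/-- **The integral `p`-stabilised plus symbol**: for `p ∤ N` and a unit `α ∈ ℤ_p^×` with
`α² − a_p α + p = 0` there are `m ∈ ℕ` and an exact `U_p`-eigensymbol `Φ ∈ Symb_{Γ₀(Np)}(Sym⁰ ℤ_p)`,
`U_p Φ = α Φ`, with values `p^m ([y]⁺ − [x]⁺ − α⁻¹([δy]⁺ − [δx]⁺))`. [cite: GreenbergStevens1993, (4.8)–(4.9)] -/
theorem exists_intStabSymb (hf : IsNewform0 f) (hQ : coeffField f = ⊥) (hΩ : plusPeriod f ≠ 0) (hpN : ¬ p ∣ N) {ap : ℚ}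
    (hap : (ap : ℂ) = cuspCoeff f p) (α : ℤ_[p]ˣ) (hα : (α : ℤ_[p]) ^ 2 - (ap : ℚ_[p]) * (α : ℤ_[p]) + p = (0 : ℚ_[p])) :
    ∃ (m : ℕ) (Φ : P1Q → P1Q → (Fin 1 → ℤ_[p])),
      Φ ∈ (CoeffActionOn.symPowOn (sigma0Set (N * p)) 0 ℤ_[p]).Symb (Gamma0 (N * p)) ∧
      (CoeffActionOn.symPowOn (sigma0Set (N * p)) 0 ℤ_[p]).hecke (N * p) p Φ = (α : ℤ_[p]) • Φ ∧
      ∀ x y i, (Φ x y i : ℚ_[p]) = (p : ℚ_[p]) ^ m *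
        (((ratPot f y - ratPot f x : ℚ) : ℚ_[p]) -
          (((α⁻¹ : ℤ_[p]ˣ) : ℤ_[p]) : ℚ_[p]) * ((ratPot f (P1Q.act (deltaMat p) y) - ratPot f (P1Q.act (deltaMat p) x) : ℚ) : ℚ_[p])) := by
  haveI : NeZero p := ⟨(Fact.out : p.Prime).ne_zero⟩
  haveI : NeZero (N * p) := ⟨mul_ne_zero (NeZero.ne N) (NeZero.ne p)⟩
  -- the unit in `ℚ_p`
  set αQ : ℚ_[p]ˣ := Units.map (PadicInt.Coe.ringHom (p := p)).toMonoidHom α with hαQ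
  have hαQv : (αQ : ℚ_[p]) = ((α : ℤ_[p]) : ℚ_[p]) := rfl
  have hαQi : ((αQ⁻¹ : ℚ_[p]ˣ) : ℚ_[p]) = (((α⁻¹ : ℤ_[p]ˣ) : ℤ_[p]) : ℚ_[p]) := by rw [hαQ, ← map_inv]; rfl
  have hα' : (αQ : ℚ_[p]) ^ 2 - (ap : ℚ_[p]) * αQ + p = 0 := by rw [hαQv]; exact hα
  obtain ⟨hmem, heig⟩ := padStabSymb_spec f hf hQ hΩ hpN hap αQ hα'
  set Ψ := padStabSymb f αQ with hΨ
  -- `Symb`-membership does not depend on the set `S` for `Sym⁰`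
  have hmem' : Ψ ∈ (CoeffActionOn.symPowOn (sigma0Set (N * p)) 0 ℚ_[p]).Symb (Gamma0 (N * p)) := hmem
  obtain ⟨m, hm⟩ := exists_pow_mul_apply_norm_le_one hmem'
  refine ⟨m, fun x y i => ⟨(p : ℚ_[p]) ^ m * Ψ x y i, hm x y i⟩, ?_, ?_, fun x y i => ?_⟩
  · refine (mapZero_mem_Symb_iff (σ := PadicInt.Coe.ringHom (p := p)) Subtype.val_injective _).mp ?_
    have hmap : mapZero (PadicInt.Coe.ringHom (p := p)) (fun x y i => (⟨(p : ℚ_[p]) ^ m * Ψ x y i, hm x y i⟩ : ℤ_[p])) =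
        ((p : ℚ_[p]) ^ m) • Ψ := by
      funext x y i; rfl
    rw [hmap]
    exact Submodule.smul_mem _ _ hmem'
  · refine (hecke_mapZero_eq_smul_iff (S := sigma0Set (N * p)) (N := N * p) (p := p) (σ := PadicInt.Coe.ringHom (p := p))
      Subtype.val_injective _ _).mp ?_
    have hmap : mapZero (PadicInt.Coe.ringHom (p := p)) (fun x y i => (⟨(p : ℚ_[p]) ^ m * Ψ x y i, hm x y i⟩ : ℤ_[p])) =
        ((p : ℚ_[p]) ^ m) • Ψ := by
      funext x y i; rfl
    rw [hmap, map_smul]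
    change ((p : ℚ_[p]) ^ m) • (CoeffActionOn.symPowOn (sigma0Set N) 0 ℚ_[p]).hecke (N * p) p Ψ = ((α : ℤ_[p]) : ℚ_[p]) • ((p : ℚ_[p]) ^ m) • Ψ
    rw [heig, smul_comm, hαQv]
  · change (p : ℚ_[p]) ^ m * Ψ x y i = _
    rw [hΨ, padStabSymb_apply, hαQi]

end Padic

end Literature.NumberTheory.EllipticCurves

end
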